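import Literature.MathematicalPhysics.QuantumFieldTheory.Balaban1983to89.B3Ineq25Op116RegularTorus
import Literature.MathematicalPhysics.QuantumFieldTheory.Balaban1983to89.B3Op116HolderKernelRegularTorusZero

/-!
# Bałaban, *(Higgs)₂,₃ quantum fields in a finite volume III. Renormalization* [B3] — inequality (2.5) p. 424, THE (1.16) ALTERNATIVE,
ON THE TORUS AT THE ONE-SIDED ORDERS `(0, n′)` AND `(n, 0)` (`n, n′ > d`): the corner left open by FILE 5(b)
`B3Ineq25Op116RegularTorus.ineq25At_op116_regularTorus` (`n, n′ ≥ 1`), supplied by FILE 4γ's `n = 0` Hölder member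
`B3Op116HolderKernelRegularTorusZero.kernel116_holder_le_zero_left'`

statement-level skeleton of published theorems with citation tags; proofs where landed; nothing here is a claim about the Yang–Mills mass gap

T. Bałaban, Commun. Math. Phys. **88** (1983) 411–445 [cite: Balaban1983Higgs3]; part I, Commun. Math. Phys. **85** (1982) 603–636
[cite: Balaban1982Higgs1].  PDFs held: `paper:balaban1983-higgs-2-3-quantum-fields-finite-volume` (journal page = PDF page + 410;
p. 414 = `p0004.txt`, p. 424 = `p0014.txt`), `paper:balaban1982-cmp85-higgs23-i` (p. 619–620 = `p0017.txt`–`p0018.txt`).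

CITATION HEADER (lean-in-tree rule).  Cell `lit-balaban` (HOME `run/shared/lean/pub/lit-balaban/`), proof seat **p35** gen 23
(unit `lit-balaban-p35`); the row owner r15's word to p40 2026-08-23T07:25:03Z *«the n′ = 0 / n = 0 corner can ride a v1.1»*.
SKELETON rows **B3.Eq2.5** (decl of record `B3Sect2StatementsPart2.ScaledKernels.Ineq25At`, fold owner r15) / **B3.Eq1.16** (analytic
half) — LOCATED MEMBER, no head claim.  USED BY NAME, never restated: p40's `B3Ineq25Op116Smooth.ineq25At_op116_smooth_torus_of_bounds`
(FILE 5(a): (2.5) from eight kernel-entry binders), `B3Ineq25Op116RegularTorus.{entry_mono, entry_mono_holder}` (FILE 5(b)), the binder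
suppliers `B3Op116DKernelRegularTorus.{kernel116_value_le, kernel116_deriv_le}` (p35, all `(n,n′)`), `B3Op116HolderKernelRegularTorus.kernel116_holder_le`
(p35, `n ≥ 1`), `B3Op116HolderKernelRegularTorusZero.kernel116_holder_le_zero_left'` (p35, `n = 0`), `B3Op116MixedKernelRegularTorus.kernel116_mixed_le`
(p40, all `(n,n′)`).

## What is printed (verbatim)

(2.5) p. 424 [PDF 14]: *"‖h(an operator δG_k(Ω,Ω₂,B̃) or (1.16))h′‖_{1,α} ≤ O(e^{−δ₀dist(Ω₂,∂Ω)} or (e(L^kε)p(L^kε))^{n+n′})e^{−δ₀dist(supp h,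
supp h′)}, (2.5)"*;  (1.16) p. 414 [PDF 4]: *"[G_k(Ω,B̃)V_k(Ã,B̃)]^n G_k(Ω,Ã+B̃) [V_k(Ã,B̃)G_k(Ω,B̃)]^{n′}, (1.16) … for n, n′ sufficiently
large, a kernel of the operator (1.16) is a sufficiently regular function of both variables"*;  [B1] p. 620 (3.45) [PDF 18]: the
ONE-SIDED expansion *"G_k(Ω,A+B) = Σ_{n=0}^{n̄} G_k(Ω,B)[V_kG_k(Ω,B)]^n + G_k(Ω,B)[V_kG_k(Ω,B)]^{n̄}V_kG_k(Ω,A+B)"* whose remainder is (1.16)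
at `n′ = 0` (cf. p. 414: *"the vertices of (1.5) are given by … (1.14) with n′ = 0 and B̃ = A^{(k)}"*).

## What this file proves, and how

**`ineq25At_op116_regularTorus_zero_left`** (`(0, n′)`, `d < n′`) and **`ineq25At_op116_regularTorus_zero_right`** (`(n, 0)`,
`d < n`): under the hypotheses of FILE 5(b) plus `L^kε ≤ 1`,
`(sect2Smooth116 …).Ineq25At 0 n′ α (min δ_G (δ₁/(4L)^{n′+1})) (C_G + K(c₁,c₂+2c₁,d,m)(valC(n′)+derC(n′)) + (holC(n′−1)+holC(n′)) + d·m·mixC(n′))`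
and its mirror image — p40's `ineq25At_op116_smooth_torus_of_bounds` at `(0,n′)` / `(n,0)` with `hV/hV′`, `hDv/hDv′` ← `kernel116_value_le`
/ `kernel116_deriv_le`, `hM/hM′` ← `kernel116_mixed_le`, and the Hölder binders `hH`/`hH′` ← `kernel116_holder_le_zero_left'` (outer factor
`G_k(T,Ã+B̃)`) and `kernel116_holder_le · 0` (outer factor `G_k(T,B̃)`), all weakened to the common rate `δ₁/(4L)^{n′+1}` and the scale
factor `(e_Rp_R)^{n′}` exactly as in FILE 5(b) (`entry_mono`, `entry_mono_holder`).  With FILE 5(b) this covers EVERY `(n, n′)` with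
`n + n′ > d`.

## Honest scope

Torus only; hypotheses = FILE 5(b)'s literal list plus `L^kε ≤ 1` (used to merge the two Hölder terms of the `n = 0` member); `α < 1`;
constants explicit, not simplified; the case `n = n′ = 0` (the kernel of `G_k(T,Ã+B̃)` itself) is below every threshold and not a case of
print's sentence.  No `def`, no new named fact, no `sorry`; axioms standard.  Value = located corner of one estimate of B3 §2 — NOT summit
progress and nothing about the Yang–Mills mass gap.
-/

noncomputable section

open scoped BigOperators

namespace Literature.MathematicalPhysics.QuantumFieldTheory.Balaban1983to89.B3Ineq25Op116RegularTorusOneSided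

open HiggsLattice (ChargeData ScalarField covDeriv)
open HiggsCovariance (propagatorK E)
open B1Eq230FluctCov (Ix cb)
open B1TorusChainTransport (hol)
open B3Ineq210RegularRegion (regRegionKernels)
open B3Ineq211RegularTorus (IsAdm)
open B3Ineq25SmoothLocalization (sect2DeltaSmooth)
open B3Ineq31SmoothLocalization (smoothConst)
open B3Ineq25Op116Smooth (sect2Smooth116 ineq25At_op116_smooth_torus_of_bounds)
open B3Op116DKernelRegularTorus (kernel116_value_le kernel116_deriv_le valC derC valC_nonneg derC_nonneg rateAt rateAt_closed cK1)
open B3Op116HolderKernelRegularTorus (kernel116_holder_le holC holC_nonneg)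
open B3Op116HolderKernelRegularTorusZero (kernel116_holder_le_zero_left')
open B3Op116MixedKernelRegularTorus (kernel116_mixed_le mixC mixC_nonneg mixRate_eq dipRate cvDip cdDip)
open B3Ineq25Op116RegularTorus (entry_mono entry_mono_holder)
open B3Eq116TwoSidedExpansion (op116)

variable {P : HiggsLattice.Params} {N : ℕ}

section Main

variable {k K₀ K₀' r₀ m : ℕ} {hL1 : 1 < P.L} {C : ChargeData N} {Ω₂ : Finset (HiggsLattice.Site P 0)} {A B : HiggsLattice.VecField P 0}
  {msq a : ℝ} {c₁ c₂ eR pR : ℝ} {δ₁ Cst CM s δA cH : ℝ}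

set_option maxHeartbeats 800000 in
/-- **(2.5), THE (1.16) ALTERNATIVE, ON THE TORUS AT THE ORDERS `(0, n′)`, `d < n′`** (outer left factor `G_k(T,Ã+B̃)`): under FILE
5(b)'s hypotheses and `L^kε ≤ 1`,
`(sect2Smooth116 …).Ineq25At 0 n′ α (min δ_G (δ₁/(4L)^{n′+1})) (C_G + K(c₁,c₂+2c₁,d,m)(valC(n′)+derC(n′)) + (holC(n′−1)+holC(n′)) + d·m·mixC(n′))`.
[cite: Balaban1983Higgs3, (2.5) p.424, (1.16) p.414, (1.32) p.420, (2.10)-(2.11) p.426] [cite: Balaban1982Higgs1, Prop. 2.1 (2.24)-(2.25) p.610, (3.44)-(3.45) p.619] -/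
theorem ineq25At_op116_regularTorus_zero_left (hL2 : 2 ≤ P.L) (hk : 1 ≤ k) (hkK : k ≤ P.K) (hmsq : 0 < msq) (ha : 0 < a)
    (hmesh : P.mesh k ≤ 1) (n' : ℕ) (hd : P.d < n')
    {α δG CG : ℝ} (hα0 : 0 ≤ α) (hα1 : α < 1) (hc₁ : 0 ≤ c₁) (hc₂ : 0 ≤ c₂) (ht0 : 0 ≤ eR * pR) (ht : P.mesh k ≤ eR * pR)
    (hCG : 0 ≤ CG) (hδG : (sect2DeltaSmooth hL1 C Finset.univ Ω₂ B msq a k K₀ r₀ m c₁ c₂).Ineq25 α δG CG)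
    (hδ₁ : 0 < δ₁) (hδ₁1 : δ₁ ≤ 1) (hCst : 0 ≤ Cst) (hCM : 0 ≤ CM)
    (h210B : (regRegionKernels hL1 C Finset.univ B msq a k K₀').Ineq210 δ₁ Cst)
    (hmixB : ∀ (j : ℕ) (μ ν : Fin P.d) (x x' : HiggsLattice.Site P 0),
      B3Ineq210MixedRegularRegion.mixedTermR C Finset.univ B msq a k j μ ν x x'
        ≤ CM * (P.mesh j ^ P.d)⁻¹ * Real.exp (-(δ₁ * ((HiggsLattice.Site.tdist x x' : ℝ) / (P.L : ℝ) ^ j))))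
    (h210AB : (regRegionKernels hL1 C Finset.univ (A + B) msq a k K₀').Ineq210 δ₁ Cst)
    (hmixAB : ∀ (j : ℕ) (μ ν : Fin P.d) (x x' : HiggsLattice.Site P 0),
      B3Ineq210MixedRegularRegion.mixedTermR C Finset.univ (A + B) msq a k j μ ν x x'
        ≤ CM * (P.mesh j ^ P.d)⁻¹ * Real.exp (-(δ₁ * ((HiggsLattice.Site.tdist x x' : ℝ) / (P.L : ℝ) ^ j))))
    (i₀ : Ix N) (hs : 0 ≤ s) (hA : ∀ b : HiggsLattice.PBond P 0, |A b| ≤ s) (hδA : 0 ≤ δA)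
    (hregA : ∀ (z : HiggsLattice.Site P 0) (μ ν : Fin P.d), |A ⟨z.shift ν, μ⟩ - A ⟨z, μ⟩| ≤ δA)
    (ht1 : P.mesh k * (|C.e| * s) ≤ 1) (hcH : 0 ≤ cH)
    (h211 : ∀ (μ : Fin P.d) (x₁ x₂ y : HiggsLattice.Site P 0), x₁ ≠ x₂ → ∀ Γ : List (HiggsLattice.Site P 0), IsAdm x₁ x₂ Γ →
      (∑ i : Ix N, ‖hol C B x₁ Γ (covDeriv C B (propagatorK C Finset.univ B msq a k (cb P N 0 (y, i))) ⟨x₂, μ⟩)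
          - covDeriv C B (propagatorK C Finset.univ B msq a k (cb P N 0 (y, i))) ⟨x₁, μ⟩‖)
          / (P.mesh 0 * (HiggsLattice.Site.tdist x₁ x₂ : ℝ)) ^ α
        ≤ ∑ j ∈ Finset.range k, cH * P.mesh j ^ (((1 : ℝ) - α) - (P.d : ℝ)) *
            (Real.exp (-(δ₁ * (P.mesh j)⁻¹ * (P.mesh 0 * (HiggsLattice.Site.tdist x₁ y : ℝ)))) +
              Real.exp (-(δ₁ * (P.mesh j)⁻¹ * (P.mesh 0 * (HiggsLattice.Site.tdist x₂ y : ℝ)))))) :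
    (sect2Smooth116 hL1 C Finset.univ Ω₂ A B msq a k K₀ r₀ m c₁ c₂ eR pR).Ineq25At 0 n' α
      (min δG (δ₁ / (4 * (P.L : ℝ)) ^ (n' + 1)))
      (CG + (smoothConst P.d m c₁ (c₂ + 2 * c₁) *
          (valC P N C k a δ₁ Cst s δA n' + derC P N C k a δ₁ Cst s δA n')
        + ((holC P N C k a δ₁ Cst s δA α cH (n' - 1) + holC P N C k a δ₁ Cst s δA α cH n')
          + P.d * m * mixC P N C k a δ₁ Cst CM s δA n'))) := by
  have hL : 1 < P.L := hL1
  have hL1r : (1 : ℝ) ≤ (P.L : ℝ) := by exact_mod_cast P.hL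
  have hn' : 1 ≤ n' := by have := P.hd; omega
  obtain ⟨m₂, rfl⟩ : ∃ m₂, n' = m₂ + 1 := ⟨n' - 1, by omega⟩
  have hdm : (P.d : ℝ) < (m₂ : ℝ) + 1 := by exact_mod_cast hd
  set M := m₂ + 1 with hM
  have hM1 : M - 1 = m₂ := by omega
  have hM12 : M - 1 + 2 = M + 1 := by omega
  -- thresholds
  have hdM : (P.d : ℝ) < (M : ℝ) := by exact_mod_cast hd
  have hdV : (P.d : ℝ) < ((0 + (m₂ + 1) : ℕ) : ℝ) + 2 := by push_cast; linarith
  have hdV' : (P.d : ℝ) < ((m₂ + 1 + 0 : ℕ) : ℝ) + 2 := by push_cast; linarith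
  have hdD : (P.d : ℝ) < ((0 + (m₂ + 1) : ℕ) : ℝ) + 1 := by push_cast; linarith
  have hdD' : (P.d : ℝ) < ((m₂ + 1 + 0 : ℕ) : ℝ) + 1 := by push_cast; linarith
  have hdH : (P.d : ℝ) < 1 + ((m₂ + 1 : ℕ) : ℝ) - α := by push_cast; linarith
  have hdH' : (P.d : ℝ) < 1 + ((m₂ + 1 + 0 : ℕ) : ℝ) - α := by push_cast; linarith
  have hdHM : (P.d : ℝ) < 1 + ((M + 1 : ℕ) : ℝ) - α := by push_cast; linarith
  have hd0 : P.d < 0 + (m₂ + 1) := by omega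
  have hd0' : P.d < m₂ + 1 + 0 := by omega
  -- signs of the constants
  have hCV : 0 ≤ valC P N C k a δ₁ Cst s δA M := valC_nonneg hL hδ₁ hCst hs hδA M (by linarith)
  have hCD : 0 ≤ derC P N C k a δ₁ Cst s δA M := derC_nonneg hL hδ₁ hCst hs hδA M (by linarith)
  have hCH0 : 0 ≤ holC P N C k a δ₁ Cst s δA α cH (M - 1) := by
    rw [hM1]; exact holC_nonneg hL hδ₁ hCst hs hδA hα1 hcH m₂ hdH
  have hCH1 : 0 ≤ holC P N C k a δ₁ Cst s δA α cH M := holC_nonneg hL hδ₁ hCst hs hδA hα1 hcH M hdHM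
  have hCH : 0 ≤ holC P N C k a δ₁ Cst s δA α cH (M - 1) + holC P N C k a δ₁ Cst s δA α cH M := add_nonneg hCH0 hCH1
  have hCM' : 0 ≤ mixC P N C k a δ₁ Cst CM s δA M := mixC_nonneg hL hδ₁ hCst hCM ha.le hs hδA (by omega)
  -- the common rate
  set δ : ℝ := δ₁ / (4 * (P.L : ℝ)) ^ (M + 1) with hδdef
  have h4L : (1 : ℝ) ≤ 4 * (P.L : ℝ) := by linarith
  have h4L0 : (0 : ℝ) < 4 * (P.L : ℝ) := by linarith
  have hδ0 : 0 ≤ δ := div_nonneg hδ₁.le (pow_nonneg h4L0.le _)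
  have hδU : δ ≤ rateAt P N C k a Cst s δA δ₁ (P.mesh 0 ^ P.d * Cst) (cK1 P C k Cst s) M := by
    rw [rateAt_closed]
    exact div_le_div_of_nonneg_left hδ₁.le (pow_pos h4L0 _) (pow_le_pow_right₀ h4L (Nat.le_succ M))
  have hδU1 : δ ≤ rateAt P N C k a Cst s δA δ₁ (P.mesh 0 ^ P.d * Cst) (cK1 P C k Cst s) (M + 1) := by
    rw [rateAt_closed]
  have hδmix : δ ≤ rateAt P N C k a Cst s δA (dipRate P δ₁) (cvDip P N C k a δ₁ Cst CM s δA) (cdDip P N C k a δ₁ Cst CM s δA)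
      (M - 1) := by
    rw [mixRate_eq, hM12]
  -- scale factors and geometry
  have hmk : 0 ≤ P.mesh k := (P.mesh_pos k).le
  have hpowM : P.mesh k ^ M ≤ (eR * pR) ^ M := pow_le_pow_left₀ hmk ht M
  have heM : 0 ≤ P.mesh k ^ M := pow_nonneg hmk M
  have hG2 : 0 ≤ P.mesh k ^ 2 * (P.mesh k ^ P.d)⁻¹ := by positivity
  have hG1 : 0 ≤ P.mesh k * (P.mesh k ^ P.d)⁻¹ := by positivity
  have hG0 : 0 ≤ (P.mesh k ^ P.d)⁻¹ := by positivity
  have hGH : 0 ≤ P.mesh k * (P.mesh k ^ P.d)⁻¹ * (P.mesh k ^ α)⁻¹ := by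
    have := Real.rpow_nonneg hmk α; positivity
  have hLk : (0 : ℝ) < (P.L : ℝ) ^ k := by positivity
  have htd : ∀ x x' : HiggsLattice.Site P 0, (0 : ℝ) ≤ (HiggsLattice.Site.tdist x x' : ℝ) / (P.L : ℝ) ^ k :=
    fun x x' => div_nonneg (Nat.cast_nonneg _) hLk.le
  have htdH : ∀ x₁ x₂ x' : HiggsLattice.Site P 0,
      (0 : ℝ) ≤ min (HiggsLattice.Site.tdist x₁ x' : ℝ) (HiggsLattice.Site.tdist x₂ x' : ℝ) / (P.L : ℝ) ^ k :=
    fun x₁ x₂ x' => div_nonneg (le_min (Nat.cast_nonneg _) (Nat.cast_nonneg _)) hLk.le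
  have hq : ∀ x₁ x₂ : HiggsLattice.Site P 0, (0 : ℝ) ≤ (P.mesh 0 * (HiggsLattice.Site.tdist x₁ x₂ : ℝ)) ^ α :=
    fun x₁ x₂ => Real.rpow_nonneg (mul_nonneg (P.mesh_pos 0).le (Nat.cast_nonneg _)) α
  have e0 : 0 + (m₂ + 1) = M := by omega
  have e0' : m₂ + 1 + 0 = M := by omega
  refine ineq25At_op116_smooth_torus_of_bounds hL2 hk hkK 0 (m₂ + 1) hα0 hα1.le hc₁ hc₂ ht0 hCG hδ0 hCV hCD hCH hCM' hδG
    ?_ ?_ ?_ ?_ ?_ ?_ ?_ ?_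
  · -- hV ← kernel116_value_le (0, n′)
    intro x x'
    have h := kernel116_value_le hδ₁ hδ₁1 hCst h210B h210AB hmsq ha hk hkK i₀ hs hA hδA hregA 0 (m₂ + 1) hdV x x'
    rw [e0] at h ⊢
    exact h.trans (entry_mono hCV heM hpowM hG2 hδU (htd x x'))
  · -- hV′ ← kernel116_value_le (n′, 0)
    intro x x'
    have h := kernel116_value_le hδ₁ hδ₁1 hCst h210B h210AB hmsq ha hk hkK i₀ hs hA hδA hregA (m₂ + 1) 0 hdV' x x'
    rw [e0'] at h
    rw [e0]
    exact h.trans (entry_mono hCV heM hpowM hG2 hδU (htd x x'))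
  · -- hDv ← kernel116_deriv_le (0, n′)
    intro μ x x'
    have h := kernel116_deriv_le hδ₁ hδ₁1 hCst h210B h210AB hmsq ha hk hkK i₀ hs hA hδA hregA 0 (m₂ + 1) hdD μ x x'
    rw [e0] at h ⊢
    exact h.trans (entry_mono hCD heM hpowM hG1 hδU (htd x x'))
  · -- hDv′ ← kernel116_deriv_le (n′, 0)
    intro μ x x'
    have h := kernel116_deriv_le hδ₁ hδ₁1 hCst h210B h210AB hmsq ha hk hkK i₀ hs hA hδA hregA (m₂ + 1) 0 hdD' μ x x'
    rw [e0'] at h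
    rw [e0]
    exact h.trans (entry_mono hCD heM hpowM hG1 hδU (htd x x'))
  · -- hH ← kernel116_holder_le_zero_left′ (0, n′): outer factor G_k(T,Ã+B̃)
    intro μ x₁ x₂ x' Γ hne hΓ
    have h := kernel116_holder_le_zero_left' hδ₁ hδ₁1 hCst h210B h210AB hmsq ha hk hkK i₀ hs hA hδA hregA hα1 hcH h211 hmesh m₂ hdH μ
      x₁ x₂ x' hne Γ hΓ
    rw [show m₂ + 2 = M + 1 by omega, ← hM1] at h
    rw [e0]
    exact h.trans (entry_mono_holder (hq x₁ x₂) hCH heM hpowM hGH hδU1 (htdH x₁ x₂ x'))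
  · -- hH′ ← kernel116_holder_le (n′ − 1, 0): outer factor G_k(T,B̃)
    intro μ x₁ x₂ x' Γ hne hΓ
    have h := kernel116_holder_le hδ₁ hδ₁1 hCst h210B h210AB hmsq ha hk hkK i₀ hs hA hδA hregA hα1 hcH h211 m₂ 0 hdH' μ
      x₁ x₂ x' hne Γ hΓ
    rw [show m₂ + 0 = M - 1 by omega, e0'] at h
    rw [e0]
    have hK : holC P N C k a δ₁ Cst s δA α cH (M - 1) ≤
        holC P N C k a δ₁ Cst s δA α cH (M - 1) + holC P N C k a δ₁ Cst s δA α cH M := le_add_of_nonneg_right hCH1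
    refine h.trans ((entry_mono_holder (hq x₁ x₂) hCH0 heM hpowM hGH hδU (htdH x₁ x₂ x')).trans ?_)
    have hE : 0 ≤ Real.exp (-(δ * (min (HiggsLattice.Site.tdist x₁ x' : ℝ) (HiggsLattice.Site.tdist x₂ x' : ℝ) / (P.L : ℝ) ^ k))) :=
      (Real.exp_pos _).le
    have hEM : 0 ≤ (eR * pR) ^ M := pow_nonneg ht0 M
    exact mul_le_mul_of_nonneg_right (mul_le_mul_of_nonneg_left
      (mul_le_mul_of_nonneg_right (mul_le_mul_of_nonneg_right hK hEM) hGH) (hq x₁ x₂)) hE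
  · -- hM ← kernel116_mixed_le (0, n′)
    intro μ ν x x'
    have h := kernel116_mixed_le hδ₁ hδ₁1 hCst hCM h210B hmixB h210AB hmixAB hmsq ha hk hkK i₀ hs hA hδA hregA ht1 0 (m₂ + 1)
      hd0 μ ν x x'
    rw [e0] at h ⊢
    exact h.trans (entry_mono hCM' heM hpowM hG0 hδmix (htd x x'))
  · -- hM′ ← kernel116_mixed_le (n′, 0)
    intro μ ν x x'
    have h := kernel116_mixed_le hδ₁ hδ₁1 hCst hCM h210B hmixB h210AB hmixAB hmsq ha hk hkK i₀ hs hA hδA hregA ht1 (m₂ + 1) 0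
      hd0' μ ν x x'
    rw [e0'] at h
    rw [e0]
    exact h.trans (entry_mono hCM' heM hpowM hG0 hδmix (htd x x'))

set_option maxHeartbeats 800000 in
/-- **(2.5), THE (1.16) ALTERNATIVE, ON THE TORUS AT THE ORDERS `(n, 0)`, `d < n`** (outer right factor `G_k(T,Ã+B̃)`; the
remainder shape of the one-sided expansion (I.3.45)): under FILE 5(b)'s hypotheses and `L^kε ≤ 1`,
`(sect2Smooth116 …).Ineq25At n 0 α (min δ_G (δ₁/(4L)^{n+1})) (C_G + K(c₁,c₂+2c₁,d,m)(valC(n)+derC(n)) + (holC(n−1)+holC(n)) + d·m·mixC(n))`.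
[cite: Balaban1983Higgs3, (2.5) p.424, (1.16) p.414, (1.32) p.420, (2.10)-(2.11) p.426] [cite: Balaban1982Higgs1, Prop. 2.1 (2.24)-(2.25) p.610, (3.44)-(3.45) p.619] -/
theorem ineq25At_op116_regularTorus_zero_right (hL2 : 2 ≤ P.L) (hk : 1 ≤ k) (hkK : k ≤ P.K) (hmsq : 0 < msq) (ha : 0 < a)
    (hmesh : P.mesh k ≤ 1) (n : ℕ) (hd : P.d < n)
    {α δG CG : ℝ} (hα0 : 0 ≤ α) (hα1 : α < 1) (hc₁ : 0 ≤ c₁) (hc₂ : 0 ≤ c₂) (ht0 : 0 ≤ eR * pR) (ht : P.mesh k ≤ eR * pR)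
    (hCG : 0 ≤ CG) (hδG : (sect2DeltaSmooth hL1 C Finset.univ Ω₂ B msq a k K₀ r₀ m c₁ c₂).Ineq25 α δG CG)
    (hδ₁ : 0 < δ₁) (hδ₁1 : δ₁ ≤ 1) (hCst : 0 ≤ Cst) (hCM : 0 ≤ CM)
    (h210B : (regRegionKernels hL1 C Finset.univ B msq a k K₀').Ineq210 δ₁ Cst)
    (hmixB : ∀ (j : ℕ) (μ ν : Fin P.d) (x x' : HiggsLattice.Site P 0),
      B3Ineq210MixedRegularRegion.mixedTermR C Finset.univ B msq a k j μ ν x x'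
        ≤ CM * (P.mesh j ^ P.d)⁻¹ * Real.exp (-(δ₁ * ((HiggsLattice.Site.tdist x x' : ℝ) / (P.L : ℝ) ^ j))))
    (h210AB : (regRegionKernels hL1 C Finset.univ (A + B) msq a k K₀').Ineq210 δ₁ Cst)
    (hmixAB : ∀ (j : ℕ) (μ ν : Fin P.d) (x x' : HiggsLattice.Site P 0),
      B3Ineq210MixedRegularRegion.mixedTermR C Finset.univ (A + B) msq a k j μ ν x x'
        ≤ CM * (P.mesh j ^ P.d)⁻¹ * Real.exp (-(δ₁ * ((HiggsLattice.Site.tdist x x' : ℝ) / (P.L : ℝ) ^ j))))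
    (i₀ : Ix N) (hs : 0 ≤ s) (hA : ∀ b : HiggsLattice.PBond P 0, |A b| ≤ s) (hδA : 0 ≤ δA)
    (hregA : ∀ (z : HiggsLattice.Site P 0) (μ ν : Fin P.d), |A ⟨z.shift ν, μ⟩ - A ⟨z, μ⟩| ≤ δA)
    (ht1 : P.mesh k * (|C.e| * s) ≤ 1) (hcH : 0 ≤ cH)
    (h211 : ∀ (μ : Fin P.d) (x₁ x₂ y : HiggsLattice.Site P 0), x₁ ≠ x₂ → ∀ Γ : List (HiggsLattice.Site P 0), IsAdm x₁ x₂ Γ →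
      (∑ i : Ix N, ‖hol C B x₁ Γ (covDeriv C B (propagatorK C Finset.univ B msq a k (cb P N 0 (y, i))) ⟨x₂, μ⟩)
          - covDeriv C B (propagatorK C Finset.univ B msq a k (cb P N 0 (y, i))) ⟨x₁, μ⟩‖)
          / (P.mesh 0 * (HiggsLattice.Site.tdist x₁ x₂ : ℝ)) ^ α
        ≤ ∑ j ∈ Finset.range k, cH * P.mesh j ^ (((1 : ℝ) - α) - (P.d : ℝ)) *
            (Real.exp (-(δ₁ * (P.mesh j)⁻¹ * (P.mesh 0 * (HiggsLattice.Site.tdist x₁ y : ℝ)))) +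
              Real.exp (-(δ₁ * (P.mesh j)⁻¹ * (P.mesh 0 * (HiggsLattice.Site.tdist x₂ y : ℝ)))))) :
    (sect2Smooth116 hL1 C Finset.univ Ω₂ A B msq a k K₀ r₀ m c₁ c₂ eR pR).Ineq25At n 0 α
      (min δG (δ₁ / (4 * (P.L : ℝ)) ^ (n + 1)))
      (CG + (smoothConst P.d m c₁ (c₂ + 2 * c₁) *
          (valC P N C k a δ₁ Cst s δA n + derC P N C k a δ₁ Cst s δA n)
        + ((holC P N C k a δ₁ Cst s δA α cH (n - 1) + holC P N C k a δ₁ Cst s δA α cH n)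
          + P.d * m * mixC P N C k a δ₁ Cst CM s δA n))) := by
  have hL : 1 < P.L := hL1
  have hL1r : (1 : ℝ) ≤ (P.L : ℝ) := by exact_mod_cast P.hL
  have hn : 1 ≤ n := by have := P.hd; omega
  obtain ⟨m₁, rfl⟩ : ∃ m₁, n = m₁ + 1 := ⟨n - 1, by omega⟩
  have hdm : (P.d : ℝ) < (m₁ : ℝ) + 1 := by exact_mod_cast hd
  set M := m₁ + 1 with hM
  have hM1 : M - 1 = m₁ := by omega
  have hM12 : M - 1 + 2 = M + 1 := by omega
  -- thresholds
  have hdM : (P.d : ℝ) < (M : ℝ) := by exact_mod_cast hd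
  have hdV : (P.d : ℝ) < ((m₁ + 1 + 0 : ℕ) : ℝ) + 2 := by push_cast; linarith
  have hdV' : (P.d : ℝ) < ((0 + (m₁ + 1) : ℕ) : ℝ) + 2 := by push_cast; linarith
  have hdD : (P.d : ℝ) < ((m₁ + 1 + 0 : ℕ) : ℝ) + 1 := by push_cast; linarith
  have hdD' : (P.d : ℝ) < ((0 + (m₁ + 1) : ℕ) : ℝ) + 1 := by push_cast; linarith
  have hdH : (P.d : ℝ) < 1 + ((m₁ + 1 + 0 : ℕ) : ℝ) - α := by push_cast; linarith
  have hdH' : (P.d : ℝ) < 1 + ((m₁ + 1 : ℕ) : ℝ) - α := by push_cast; linarith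
  have hdHM : (P.d : ℝ) < 1 + ((M + 1 : ℕ) : ℝ) - α := by push_cast; linarith
  have hd0 : P.d < m₁ + 1 + 0 := by omega
  have hd0' : P.d < 0 + (m₁ + 1) := by omega
  -- signs of the constants
  have hCV : 0 ≤ valC P N C k a δ₁ Cst s δA M := valC_nonneg hL hδ₁ hCst hs hδA M (by linarith)
  have hCD : 0 ≤ derC P N C k a δ₁ Cst s δA M := derC_nonneg hL hδ₁ hCst hs hδA M (by linarith)
  have hCH0 : 0 ≤ holC P N C k a δ₁ Cst s δA α cH (M - 1) := by
    rw [hM1]; exact holC_nonneg hL hδ₁ hCst hs hδA hα1 hcH m₁ hdH'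
  have hCH1 : 0 ≤ holC P N C k a δ₁ Cst s δA α cH M := holC_nonneg hL hδ₁ hCst hs hδA hα1 hcH M hdHM
  have hCH : 0 ≤ holC P N C k a δ₁ Cst s δA α cH (M - 1) + holC P N C k a δ₁ Cst s δA α cH M := add_nonneg hCH0 hCH1
  have hCM' : 0 ≤ mixC P N C k a δ₁ Cst CM s δA M := mixC_nonneg hL hδ₁ hCst hCM ha.le hs hδA (by omega)
  -- the common rate
  set δ : ℝ := δ₁ / (4 * (P.L : ℝ)) ^ (M + 1) with hδdef
  have h4L : (1 : ℝ) ≤ 4 * (P.L : ℝ) := by linarith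
  have h4L0 : (0 : ℝ) < 4 * (P.L : ℝ) := by linarith
  have hδ0 : 0 ≤ δ := div_nonneg hδ₁.le (pow_nonneg h4L0.le _)
  have hδU : δ ≤ rateAt P N C k a Cst s δA δ₁ (P.mesh 0 ^ P.d * Cst) (cK1 P C k Cst s) M := by
    rw [rateAt_closed]
    exact div_le_div_of_nonneg_left hδ₁.le (pow_pos h4L0 _) (pow_le_pow_right₀ h4L (Nat.le_succ M))
  have hδU1 : δ ≤ rateAt P N C k a Cst s δA δ₁ (P.mesh 0 ^ P.d * Cst) (cK1 P C k Cst s) (M + 1) := by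
    rw [rateAt_closed]
  have hδmix : δ ≤ rateAt P N C k a Cst s δA (dipRate P δ₁) (cvDip P N C k a δ₁ Cst CM s δA) (cdDip P N C k a δ₁ Cst CM s δA)
      (M - 1) := by
    rw [mixRate_eq, hM12]
  -- scale factors and geometry
  have hmk : 0 ≤ P.mesh k := (P.mesh_pos k).le
  have hpowM : P.mesh k ^ M ≤ (eR * pR) ^ M := pow_le_pow_left₀ hmk ht M
  have heM : 0 ≤ P.mesh k ^ M := pow_nonneg hmk M
  have hG2 : 0 ≤ P.mesh k ^ 2 * (P.mesh k ^ P.d)⁻¹ := by positivity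
  have hG1 : 0 ≤ P.mesh k * (P.mesh k ^ P.d)⁻¹ := by positivity
  have hG0 : 0 ≤ (P.mesh k ^ P.d)⁻¹ := by positivity
  have hGH : 0 ≤ P.mesh k * (P.mesh k ^ P.d)⁻¹ * (P.mesh k ^ α)⁻¹ := by
    have := Real.rpow_nonneg hmk α; positivity
  have hLk : (0 : ℝ) < (P.L : ℝ) ^ k := by positivity
  have htd : ∀ x x' : HiggsLattice.Site P 0, (0 : ℝ) ≤ (HiggsLattice.Site.tdist x x' : ℝ) / (P.L : ℝ) ^ k :=
    fun x x' => div_nonneg (Nat.cast_nonneg _) hLk.le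
  have htdH : ∀ x₁ x₂ x' : HiggsLattice.Site P 0,
      (0 : ℝ) ≤ min (HiggsLattice.Site.tdist x₁ x' : ℝ) (HiggsLattice.Site.tdist x₂ x' : ℝ) / (P.L : ℝ) ^ k :=
    fun x₁ x₂ x' => div_nonneg (le_min (Nat.cast_nonneg _) (Nat.cast_nonneg _)) hLk.le
  have hq : ∀ x₁ x₂ : HiggsLattice.Site P 0, (0 : ℝ) ≤ (P.mesh 0 * (HiggsLattice.Site.tdist x₁ x₂ : ℝ)) ^ α :=
    fun x₁ x₂ => Real.rpow_nonneg (mul_nonneg (P.mesh_pos 0).le (Nat.cast_nonneg _)) α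
  have e0 : m₁ + 1 + 0 = M := by omega
  have e0' : 0 + (m₁ + 1) = M := by omega
  refine ineq25At_op116_smooth_torus_of_bounds hL2 hk hkK (m₁ + 1) 0 hα0 hα1.le hc₁ hc₂ ht0 hCG hδ0 hCV hCD hCH hCM' hδG
    ?_ ?_ ?_ ?_ ?_ ?_ ?_ ?_
  · -- hV ← kernel116_value_le (n, 0)
    intro x x'
    have h := kernel116_value_le hδ₁ hδ₁1 hCst h210B h210AB hmsq ha hk hkK i₀ hs hA hδA hregA (m₁ + 1) 0 hdV x x'
    rw [e0] at h ⊢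
    exact h.trans (entry_mono hCV heM hpowM hG2 hδU (htd x x'))
  · -- hV′ ← kernel116_value_le (0, n)
    intro x x'
    have h := kernel116_value_le hδ₁ hδ₁1 hCst h210B h210AB hmsq ha hk hkK i₀ hs hA hδA hregA 0 (m₁ + 1) hdV' x x'
    rw [e0'] at h
    rw [e0]
    exact h.trans (entry_mono hCV heM hpowM hG2 hδU (htd x x'))
  · -- hDv ← kernel116_deriv_le (n, 0)
    intro μ x x'
    have h := kernel116_deriv_le hδ₁ hδ₁1 hCst h210B h210AB hmsq ha hk hkK i₀ hs hA hδA hregA (m₁ + 1) 0 hdD μ x x'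
    rw [e0] at h ⊢
    exact h.trans (entry_mono hCD heM hpowM hG1 hδU (htd x x'))
  · -- hDv′ ← kernel116_deriv_le (0, n)
    intro μ x x'
    have h := kernel116_deriv_le hδ₁ hδ₁1 hCst h210B h210AB hmsq ha hk hkK i₀ hs hA hδA hregA 0 (m₁ + 1) hdD' μ x x'
    rw [e0'] at h
    rw [e0]
    exact h.trans (entry_mono hCD heM hpowM hG1 hδU (htd x x'))
  · -- hH ← kernel116_holder_le (n − 1, 0): outer factor G_k(T,B̃)
    intro μ x₁ x₂ x' Γ hne hΓ
    have h := kernel116_holder_le hδ₁ hδ₁1 hCst h210B h210AB hmsq ha hk hkK i₀ hs hA hδA hregA hα1 hcH h211 m₁ 0 hdH μ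
      x₁ x₂ x' hne Γ hΓ
    rw [show m₁ + 0 = M - 1 by omega, e0] at h
    rw [e0]
    have hK : holC P N C k a δ₁ Cst s δA α cH (M - 1) ≤
        holC P N C k a δ₁ Cst s δA α cH (M - 1) + holC P N C k a δ₁ Cst s δA α cH M := le_add_of_nonneg_right hCH1
    refine h.trans ((entry_mono_holder (hq x₁ x₂) hCH0 heM hpowM hGH hδU (htdH x₁ x₂ x')).trans ?_)
    have hE : 0 ≤ Real.exp (-(δ * (min (HiggsLattice.Site.tdist x₁ x' : ℝ) (HiggsLattice.Site.tdist x₂ x' : ℝ) / (P.L : ℝ) ^ k))) :=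
      (Real.exp_pos _).le
    have hEM : 0 ≤ (eR * pR) ^ M := pow_nonneg ht0 M
    exact mul_le_mul_of_nonneg_right (mul_le_mul_of_nonneg_left
      (mul_le_mul_of_nonneg_right (mul_le_mul_of_nonneg_right hK hEM) hGH) (hq x₁ x₂)) hE
  · -- hH′ ← kernel116_holder_le_zero_left′ (0, n): outer factor G_k(T,Ã+B̃)
    intro μ x₁ x₂ x' Γ hne hΓ
    have h := kernel116_holder_le_zero_left' hδ₁ hδ₁1 hCst h210B h210AB hmsq ha hk hkK i₀ hs hA hδA hregA hα1 hcH h211 hmesh m₁ hdH' μ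
      x₁ x₂ x' hne Γ hΓ
    rw [show m₁ + 2 = M + 1 by omega, ← hM1] at h
    rw [e0]
    exact h.trans (entry_mono_holder (hq x₁ x₂) hCH heM hpowM hGH hδU1 (htdH x₁ x₂ x'))
  · -- hM ← kernel116_mixed_le (n, 0)
    intro μ ν x x'
    have h := kernel116_mixed_le hδ₁ hδ₁1 hCst hCM h210B hmixB h210AB hmixAB hmsq ha hk hkK i₀ hs hA hδA hregA ht1 (m₁ + 1) 0
      hd0 μ ν x x'
    rw [e0] at h ⊢
    exact h.trans (entry_mono hCM' heM hpowM hG0 hδmix (htd x x'))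
  · -- hM′ ← kernel116_mixed_le (0, n)
    intro μ ν x x'
    have h := kernel116_mixed_le hδ₁ hδ₁1 hCst hCM h210B hmixB h210AB hmixAB hmsq ha hk hkK i₀ hs hA hδA hregA ht1 0 (m₁ + 1)
      hd0' μ ν x x'
    rw [e0'] at h
    rw [e0]
    exact h.trans (entry_mono hCM' heM hpowM hG0 hδmix (htd x x'))

end Main

end Literature.MathematicalPhysics.QuantumFieldTheory.Balaban1983to89.B3Ineq25Op116RegularTorusOneSided

end
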